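import Summits.ResolutionOfSingularities.ResolutionOfSingularities.Theses.RuledResidues
import Literature.AlgebraicGeometry.Resolution.AffineDomainDimension
import Literature.AlgebraicGeometry.Resolution.ResolutionOfCurves
import Literature.AlgebraicGeometry.Resolution.RegularLocalRingsNormal
import Literature.AlgebraicGeometry.Resolution.DivisorialPlace

/-!
# Disproof work file — crux `NonRuledCofinite` (stmt-ResolutionOfSingularities-18076)

Route `ResolutionOfSingularities/RuledResidues`; crux decl
`Summit.ResolutionOfSingularities.ResolutionOfSingularities.Theses.RuledResidues.NonRuledCofinite`:
for fields `k ⊆ K`, an affine model `R ⊆ K` (`R.FG`, `Frac R = K`) with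
`Scheme.HasResolution (Spec R)`, the set of `W : ValuationSubring K` with
(1) `k ⊆ W`, (2) `W` a DVR, (3) `W` a localisation of a finitely generated `k`-algebra,
(4) `R ⊆ W` AND `R_{𝔪_W ∩ R}` NOT regular, (5) `W` dominates NO regular local ring of dimension
`≥ 2` of an affine model `A` of `K` — is finite.

## Findings (cdisprove seat `refuter-cdisprove-stmt-ResolutionOfSingularities-18076-0`, cycle 1)

**VERDICT: NO KILL — the crux is TRUE** (paper proof, agreeing with the batch refuter's stamp and
the strategist's census): let `π : X → Spec R` be the resolution; `IsBirational` (tree definition: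
iso over a dense open `U` with dense preimage) makes `X` integral with function field `K`;
a `W` in the set has a centre `x ∈ X` (valuative criterion; `W ⊇ R`, `π` proper); if
`dim 𝒪_{X,x} ≥ 2` then the affine chart `A = Γ(X,V) ↪ K` around `x` violates (5); `dim = 0` is
excluded by (4) (`R_(0) = K` is regular); so `W` dominates the DVR `𝒪_{X,x}`, hence `W = 𝒪_{X,x}`
with `x` a codimension-one point; `x ∉ π⁻¹U` by (4) (`𝒪_{X,x} ≅ R_{π x}` there), and the
codimension-one points of the proper closed `X ∖ π⁻¹U` of the Noetherian `X` are the generic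
points of its finitely many components.  No loophole was found in the typed interface
(`IsBirational` forbids extra components: the preimage of `U` must be DENSE in `X`;
`Scheme.IsRegular` + finite type over the Noetherian `R` makes `X` Noetherian; `W = K` is excluded
by (4); `↥W` vs `↥W.toSubring` and `↥A` vs `↥A.toSubring` are definitional, checked below by use).

**(a) LOAD-BEARING HYPOTHESES** (drop one at a time):
* singular-centre clause of (4) — LOAD-BEARING, PROVED below:
  `nonRuledCofinite_false_without_singularCentre` (witness `R = k[X] ⊆ k(X)`, `k = 𝔽₂^alg`: a
  regular curve is its own resolution, every place `X - c` passes (1)(2)(3)(5) and `R ⊆ W`;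
  infinitely many).  Landed as `Theorems/NonRuledCofinite/Negative/FalseWithoutSingularCentre.lean`.
* `HasResolution (Spec R)` — NOT ATTACKABLE: the crux without it is "NRF" (non-dominating
  divisorial places over `Sing R` are finite for EVERY affine model), a consequence of resolution in
  all characteristics (true in char 0 / dim ≤ 3, open otherwise) — refuting it IS the route's
  witness hunt (crux `NonRuledDivisors`, not this item).
* the threshold `2` in (5) — TIGHT: with `1 ≤ dim` (or no bound) the set is EMPTY for every `R`,
  resolution or not — PROVED below (§(b) `nonRuledCofinite_threshold_one_vacuous`: a `W` in the set
  is `B_𝔮` for the f.g. `B` of (3); `A := R ⊔ B` has `A_{𝔪_W ∩ A} ≅ W`, regular of dimension `1`),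
  so `2` is the first value with content; with `3` the
  statement is FALSE (normal surface singularity `R`, e.g. `k[t²,t³][y]` or a cone: the infinitely
  many divisorial valuations centred at a singular point dominate regular local rings of dimension
  exactly `2` = closed points of the minimal resolution) — not formalised (needs the blow-up
  divisors of a surface as `ValuationSubring`s; the tree has `HasResolution` only for curves
  unconditionally).
* `IsFractionRing R K` — NOT load-bearing for TRUTH whenever `K` has a regular proper model
  (then the set is `{𝒪_{X,D} : D prime divisor, v_D(f) > 0}` for one `0 ≠ f ∈ R ∩ I(Sing R)`,
  finite), but load-bearing for the METHOD (without `Frac R = K` a resolution of `Spec R` says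
  nothing about `K`); no cheap witness either way.
* `R.FG` — dropping it leads to non-Noetherian bases; no model found, not pursued.
* conjuncts (1), (2), (3) — IDLE (also the batch refuter's MUTATION note): (1) follows from
  `R ⊆ W`; given `HasResolution`, (4) and (5) force `W = 𝒪_{X,x}` for a codimension-one `x`, which
  is a DVR essentially of finite type.  Provers may ignore `hk`, `hdvr`, `hft`.

**(b)/(c) TIGHTNESS / NATURAL STRENGTHENINGS**:
* "the set is EMPTY" is FALSE: at the cusp `R = k[t²,t³] ⊆ k(t)` (which HAS a resolution —
  `hasResolution_of_dim_le_one`, unconditional in the tree) the place `W = k[t]_{(t)}` satisfies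
  (1)–(5): centred at the cusp, whose local ring is not regular (not integrally closed: `t ∉ R_𝔮`,
  `t² ∈ R`), and (5) is automatic in transcendence degree one.  Lean: §Cusp below
  (`cusp_mem_exceptionalSet`, `not_nonRuledCofinite_empty`).
* conjunct (5) is AUTOMATIC in `trdeg 1` (`not_exists_goodModel`): the crux has content only for
  `trdeg_k K ≥ 2`.

**(d) TARGETS** — none served (`stuck_stubs = []`; no `PICKED.md`).  The registered line
`Lines/regular_atlas.lean` (3 stubs, composition proved) was read: all three stubs are TRUE on
paper (checked case by case in NOTES); mutation notes for the lead:
* `stub_exceptionalPrimesFinite`: hypothesis `hR : R.FG` is IDLE (only `B.FG` and `Frac R = K`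
  are used: common denominator + `B` Noetherian); the clause `ht 𝔭 = 1` is LOAD-BEARING — Lean:
  §Line stub 3 below, `stub_exceptionalPrimesFinite_false_without_heightOne` (cusp × line
  `k[t²,t³,y] ≤ k[t,y] ⊆ Frac k[y][t]`: every maximal ideal `(t, y - c)` of the regular chart
  contracts to a singular point — infinitely many primes of height two in the mutated set).
* `stub_exceptionalCentre`: `IsRegularRing B` is LOAD-BEARING — at the cusp `R = B = k[t²,t³]`,
  `W = k[t]_{(t)}`: hypotheses hold, `ht 𝔭 = 1` holds, but `W ≠ B_𝔭` (`t ∈ W ∖ B_𝔭`).  Lean: §Cusp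
  (`stub_exceptionalCentre_false_without_isRegularRing`).  `hB : B.FG` is used only to instantiate
  (5) at `A := B`.

## Contents
* §RatFunc — `trdeg_k k(X) = 1`, affine models of `k(X)` have dimension `≤ 1` and a resolution
  (`hasResolution_spec`), conjunct (5) is automatic (`not_exists_goodModel`), the places
  `place v = k[X]_v` (DVR, essentially of finite type), `X - c ↦ place` injective.
* §(a) — `NonRuledCofiniteWithoutSingularCentre`, `nonRuledCofinite_false_without_singularCentre`.
* §(b) — threshold tightness: `exists_goodModel_of_dim_one`, `nonRuledCofinite_threshold_one_vacuous`.
* §Cusp — the cuspidal model `k[t², t³]`, non-regularity of its local ring at the cusp, the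
  exceptional set of the crux is non-empty there; stub-2 mutation.
* §Line stub 3 — the cusp × line `k[t², t³, y] ≤ k[t, y] ⊆ Frac k[y][t]`; stub-3 mutation.

LANDED (Negative lane, `--supports stmt-ResolutionOfSingularities-18076`; namespace
`Summit.ResolutionOfSingularities.ResolutionOfSingularities.Theorems.NonRuledCofinite.Negative`,
importable by ideators / planners / the lead):
* `Theorems/NonRuledCofinite/Negative/FalseWithoutSingularCentre.lean` — p153248 ACCEPTED
  (`nonRuledCofinite_false_without_singularCentre` + the `k(X)` kit: `polyModel`, `place`,
  `hasResolution_spec`, `not_exists_goodModel`, `place_essFiniteType`).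
* `Theorems/NonRuledCofinite/Negative/StubExceptionalPrimesWithoutHeightOne.lean` — p153621
  ACCEPTED (`stub_exceptionalPrimesFinite_false_without_heightOne`,
  `not_isRegularLocalRing_localization_of_pow_mem`, `planeModel`, `cuspLineModel`, `pointIdeal`).
* `Theorems/NonRuledCofinite/Negative/CuspExceptionalSet.lean` — p154334 (submitted)
  (`nonRuledCofinite_threshold_one_vacuous`, `exists_goodModel_of_dim_one`,
  `not_isRegularLocalRing_cusp`, `cuspPlace_mem_exceptionalSet`, `not_nonRuledCofinite_empty`,
  `stub_exceptionalCentre_false_without_isRegularRing`).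
-/

noncomputable section

set_option linter.dupNamespace false

open Polynomial IsDedekindDomain AlgebraicGeometry
open Literature.AlgebraicGeometry.Resolution

namespace Summit.ResolutionOfSingularities.ResolutionOfSingularities.Cruxes.NonRuledCofinite.Disproof

variable (k : Type) [Field k]

/-- `trdeg_k k(X) = 1`. -/
theorem trdeg_ratFunc : Algebra.trdeg k (RatFunc k) = 1 := by
  haveI : Algebra.IsAlgebraic k[X] (RatFunc k) :=
    IsLocalization.isAlgebraic (RatFunc k) (nonZeroDivisors k[X])
  have h := trdeg_add_eq k k[X] (A := RatFunc k)
  rw [trdeg_eq_zero (R := k[X]) (A := RatFunc k), add_zero, Polynomial.trdeg_of_isDomain] at h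
  exact h.symm

/-- Affine models of `k(X)` have Krull dimension `≤ 1`. -/
theorem ringKrullDim_le_one (A : Subalgebra k (RatFunc k)) (hA : A.FG)
    [IsFractionRing A (RatFunc k)] : ringKrullDim A ≤ 1 :=
  ringKrullDim_le_of_fg_of_trdeg_le A hA (d := 1) (by rw [trdeg_ratFunc]; exact_mod_cast le_rfl)

/-- No local ring of an affine model of `k(X)` has dimension `≥ 2`. -/
theorem not_two_le_ringKrullDim_localization (A : Subalgebra k (RatFunc k)) (hA : A.FG)
    [IsFractionRing A (RatFunc k)] (q : Ideal A) [q.IsPrime] :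
    ¬ (2 : WithBot ℕ∞) ≤ ringKrullDim (Localization.AtPrime q) := by
  intro h2
  have h := IsLocalization.AtPrime.ringKrullDim_eq_height q (Localization.AtPrime q)
  have hq : (q.height : WithBot ℕ∞) ≤ ringKrullDim A := Ideal.height_le_ringKrullDim_of_isPrime
  have h1 := ringKrullDim_le_one k A hA
  have : (2 : WithBot ℕ∞) ≤ 1 := h2.trans (h ▸ hq.trans h1)
  exact absurd this (by decide)

/-- Affine curves have resolutions: `Spec A` for an affine model `A` of `k(X)`. -/
theorem hasResolution_spec (A : Subalgebra k (RatFunc k)) (hA : A.FG)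
    [IsFractionRing A (RatFunc k)] : Scheme.HasResolution (Spec (CommRingCat.of A)) := by
  haveI : Algebra.FiniteType k A := A.fg_iff_finiteType.mp hA
  let f : Spec (.of A) ⟶ Spec (.of k) := Spec.map (CommRingCat.ofHom (algebraMap k A))
  haveI : LocallyOfFiniteType f :=
    (HasRingHomProperty.Spec_iff (P := @LocallyOfFiniteType)).mpr
      (RingHom.finiteType_algebraMap.mpr ‹_›)
  have hdim : topologicalKrullDim (Spec (.of A)) ≤ 1 :=
    (le_of_eq (PrimeSpectrum.topologicalKrullDim_eq_ringKrullDim (R := A))).trans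
      (ringKrullDim_le_one k A hA)
  exact hasResolution_of_dim_le_one (Spec (.of A)) f hdim

/-- The polynomial ring as a `k`-subalgebra of `k(X)`. -/
def polyModel : Subalgebra k (RatFunc k) := (IsScalarTower.toAlgHom k k[X] (RatFunc k)).range

theorem mem_polyModel_iff {x : RatFunc k} :
    x ∈ polyModel k ↔ ∃ p : k[X], algebraMap k[X] (RatFunc k) p = x := by
  simp [polyModel, AlgHom.mem_range]

theorem algebraMap_mem_polyModel (p : k[X]) : algebraMap k[X] (RatFunc k) p ∈ polyModel k :=
  (mem_polyModel_iff k).mpr ⟨p, rfl⟩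

theorem polyModel_fg : (polyModel k).FG := by
  have h : (⊤ : Subalgebra k k[X]).FG := Algebra.FiniteType.out
  have := h.map (IsScalarTower.toAlgHom k k[X] (RatFunc k))
  rwa [Algebra.map_top] at this

example : FaithfulSMul (polyModel k) (RatFunc k) := inferInstance

instance isFractionRing_polyModel : IsFractionRing (polyModel k) (RatFunc k) := by
  refine IsFractionRing.of_field (polyModel k) (RatFunc k) fun z => ?_
  refine ⟨⟨_, algebraMap_mem_polyModel k z.num⟩, ⟨_, algebraMap_mem_polyModel k z.denom⟩, ?_⟩
  exact (RatFunc.num_div_denom z).symm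


/-! ## Places of `k(X)` -/

variable {k}

/-- The place of `k(X)` at a non-zero prime `v` of `k[X]`: the localisation `k[X]_v` as a
valuation subring of `k(X)` (Mathlib's `valuationSubringAtPrime`). -/
abbrev place (v : HeightOneSpectrum k[X]) : ValuationSubring (RatFunc k) :=
  v.valuationSubringAtPrime (RatFunc k)

theorem algebraMap_mem_place (v : HeightOneSpectrum k[X]) (p : k[X]) :
    algebraMap k[X] (RatFunc k) p ∈ place v :=
  Subalgebra.algebraMap_mem
    (Localization.subalgebra.ofField (RatFunc k) _ v.asIdeal.primeCompl_le_nonZeroDivisors) p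

theorem polyModel_le_place (v : HeightOneSpectrum k[X]) :
    (polyModel k).toSubring ≤ (place v).toSubring := by
  rintro x hx
  obtain ⟨p, rfl⟩ := (mem_polyModel_iff k).mp hx
  exact algebraMap_mem_place v p

theorem algebraMap_base_mem_place (v : HeightOneSpectrum k[X]) (c : k) :
    algebraMap k (RatFunc k) c ∈ place v := by
  rw [IsScalarTower.algebraMap_apply k k[X] (RatFunc k) c]
  exact algebraMap_mem_place v _

instance isDiscreteValuationRing_place (v : HeightOneSpectrum k[X]) :
    IsDiscreteValuationRing (place v) :=
  IsLocalization.AtPrime.isDiscreteValuationRing_of_dedekind_domain k[X] v.ne_bot (place v)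

theorem mem_place_iff_valuation_le_one (v : HeightOneSpectrum k[X]) (x : RatFunc k) :
    x ∈ place v ↔ v.valuation (RatFunc k) x ≤ 1 := by
  rw [place, HeightOneSpectrum.valuationSubringAtPrime_eq_valuationSubring,
    Valuation.mem_valuationSubring_iff]

/-- The image of `p ∉ v` is a unit of the place, hence not in its non-units. -/
theorem algebraMap_not_mem_nonunits (v : HeightOneSpectrum k[X]) {p : k[X]}
    (hp : p ∈ v.asIdeal.primeCompl) : algebraMap k[X] (RatFunc k) p ∉ (place v).nonunits := by
  intro hmem
  have hu : IsUnit (algebraMap k[X] (place v) p) := IsLocalization.map_units (place v) ⟨p, hp⟩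
  have hmax := (ValuationSubring.coe_mem_nonunits_iff (A := place v)).mp
    (show ((algebraMap k[X] (place v) p : place v) : RatFunc k) ∈ (place v).nonunits from hmem)
  exact (IsLocalRing.mem_maximalIdeal _).mp hmax hu

/-- Divisorial shape (crux conjunct 3) of a place: it is the localisation of `k[X]`. -/
theorem place_essFiniteType (v : HeightOneSpectrum k[X]) :
    ∃ B : Subalgebra k (RatFunc k), B.FG ∧ B.toSubring ≤ (place v).toSubring ∧
      ∀ x : RatFunc k, x ∈ place v → ∃ b s : RatFunc k, b ∈ B ∧ s ∈ B ∧
        s ∉ (place v).nonunits ∧ x * s = b := by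
  refine ⟨polyModel k, polyModel_fg k, polyModel_le_place v, fun x hx => ?_⟩
  obtain ⟨n, d, hnd⟩ := HeightOneSpectrum.exists_primeCompl_mul_eq_of_integer v x
    ((mem_place_iff_valuation_le_one v x).mp hx)
  exact ⟨_, _, algebraMap_mem_polyModel k n, algebraMap_mem_polyModel k d,
    algebraMap_not_mem_nonunits v d.2, hnd⟩

/-- The place at the linear polynomial `X - c`. -/
def linPlace (c : k) : HeightOneSpectrum k[X] where
  asIdeal := Ideal.span {X - C c}
  isPrime := (Ideal.span_singleton_prime (X_sub_C_ne_zero c)).mpr (prime_X_sub_C c)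
  ne_bot := by simp [X_sub_C_ne_zero]

theorem place_linPlace_injective : Function.Injective fun c : k => place (linPlace c) := by
  intro c₁ c₂ h
  by_contra hne
  simp only at h
  set t : RatFunc k := algebraMap k[X] (RatFunc k) (X - C c₁) with ht
  have ht0 : t ≠ 0 := by
    rw [ht, Ne, FaithfulSMul.algebraMap_eq_zero_iff]
    exact X_sub_C_ne_zero c₁
  -- `t⁻¹ ∈ place c₂`: `X - C c₁ ∉ (X - C c₂)`, so `t` is a `v₂`-unit
  have hmem₂ : t⁻¹ ∈ place (linPlace c₂) := by
    have hp : X - C c₁ ∈ (linPlace c₂).asIdeal.primeCompl := by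
      intro hdvd
      change X - C c₁ ∈ Ideal.span {X - C c₂} at hdvd
      rw [Ideal.mem_span_singleton, Polynomial.dvd_iff_isRoot] at hdvd
      simp [sub_eq_zero] at hdvd
      exact hne hdvd.symm
    rw [mem_place_iff_valuation_le_one, map_inv₀, ht, HeightOneSpectrum.valuation_of_algebraMap,
      ((linPlace c₂).intValuation_eq_one_iff_mem_primeCompl _).mpr hp, inv_one]
  -- `t⁻¹ ∉ place c₁`: `v₁ t < 1`
  have hnmem₁ : t⁻¹ ∉ place (linPlace c₁) := by
    rw [mem_place_iff_valuation_le_one, map_inv₀, inv_le_one₀, not_le, ht]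
    · exact (HeightOneSpectrum.valuation_lt_one_iff_mem _ _).mpr (Ideal.mem_span_singleton_self _)
    · exact (Valuation.pos_iff _).mpr ht0
  exact hnmem₁ (h ▸ hmem₂)

/-- Conjunct (5) of the crux is AUTOMATIC in `k(X)`: no affine model of a function field of
transcendence degree one has a local ring of dimension `≥ 2`. -/
theorem not_exists_goodModel (W : ValuationSubring (RatFunc k)) :
    ¬ ∃ A : Subalgebra k (RatFunc k), A.FG ∧ IsFractionRing A (RatFunc k) ∧
      ∃ h : A.toSubring ≤ W.toSubring,
        IsRegularLocalRing (Localization.AtPrime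
          (Ideal.comap (Subring.inclusion h) (IsLocalRing.maximalIdeal W))) ∧
        (2 : WithBot ℕ∞) ≤ ringKrullDim (Localization.AtPrime
          (Ideal.comap (Subring.inclusion h) (IsLocalRing.maximalIdeal W))) := by
  rintro ⟨A, hA, hfr, h, -, hdim⟩
  exact not_two_le_ringKrullDim_localization k A hA _ hdim

/-! ## (a) LOAD-BEARING: the singular-centre clause of conjunct (4)

`NonRuledCofiniteWithoutSingularCentre` is the crux with "`R_{𝔪_W ∩ R}` is not regular" deleted
from conjunct (4) (keeping `R ⊆ W`).  It is FALSE: at the regular curve `R = k[X] ⊆ k(X)` EVERY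
place `W ∋ k[X]` satisfies the remaining conjuncts, and there are infinitely many (`X - c`,
`c ∈ k`, `k` infinite).  So any proof of the crux must use the singular-centre clause: it is what
confines `W` to the complement of the isomorphism locus of the resolution. -/

/-- The crux `NonRuledCofinite` with the non-regularity clause of conjunct (4) dropped. -/
def NonRuledCofiniteWithoutSingularCentre : Prop :=
  ∀ (k K : Type) [Field k] [Field K] [Algebra k K] (R : Subalgebra k K), R.FG →
    IsFractionRing R K →
    Literature.AlgebraicGeometry.Resolution.Scheme.HasResolution
      (AlgebraicGeometry.Spec (CommRingCat.of R)) →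
    Set.Finite {W : ValuationSubring K | (∀ c : k, algebraMap k K c ∈ W) ∧
      IsDiscreteValuationRing W ∧
      (∃ B : Subalgebra k K, B.FG ∧ B.toSubring ≤ W.toSubring ∧ ∀ x : K, x ∈ W →
        ∃ b s : K, b ∈ B ∧ s ∈ B ∧ s ∉ W.nonunits ∧ x * s = b) ∧
      R.toSubring ≤ W.toSubring ∧
      ¬ (∃ A : Subalgebra k K, A.FG ∧ IsFractionRing A K ∧ ∃ h : A.toSubring ≤ W.toSubring,
        IsRegularLocalRing (Localization.AtPrime
          (Ideal.comap (Subring.inclusion h) (IsLocalRing.maximalIdeal W))) ∧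
        (2 : WithBot ℕ∞) ≤ ringKrullDim (Localization.AtPrime
          (Ideal.comap (Subring.inclusion h) (IsLocalRing.maximalIdeal W))))}

variable (k) in
/-- Over an infinite field, the mutated set at `R = k[X] ⊆ k(X)` is infinite: it contains the
pairwise distinct places `X - c`, `c ∈ k`. -/
theorem infinite_mutatedSet_polyModel [Infinite k] :
    Set.Infinite {W : ValuationSubring (RatFunc k) | (∀ c : k, algebraMap k (RatFunc k) c ∈ W) ∧
      IsDiscreteValuationRing W ∧
      (∃ B : Subalgebra k (RatFunc k), B.FG ∧ B.toSubring ≤ W.toSubring ∧ ∀ x : RatFunc k,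
        x ∈ W → ∃ b s : RatFunc k, b ∈ B ∧ s ∈ B ∧ s ∉ W.nonunits ∧ x * s = b) ∧
      (polyModel k).toSubring ≤ W.toSubring ∧
      ¬ (∃ A : Subalgebra k (RatFunc k), A.FG ∧ IsFractionRing A (RatFunc k) ∧
        ∃ h : A.toSubring ≤ W.toSubring,
        IsRegularLocalRing (Localization.AtPrime
          (Ideal.comap (Subring.inclusion h) (IsLocalRing.maximalIdeal W))) ∧
        (2 : WithBot ℕ∞) ≤ ringKrullDim (Localization.AtPrime
          (Ideal.comap (Subring.inclusion h) (IsLocalRing.maximalIdeal W))))} := by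
  refine Set.Infinite.mono ?_ (Set.infinite_range_of_injective place_linPlace_injective)
  rintro _ ⟨c, rfl⟩
  exact ⟨algebraMap_base_mem_place _, inferInstance, place_essFiniteType _, polyModel_le_place _,
    not_exists_goodModel _⟩

/-- **Any proof of `NonRuledCofinite` must use the singular-centre clause**: with it deleted the
statement fails at `k = 𝔽₂^alg` (any infinite field works), `K = k(X)`, `R = k[X]` — a regular
curve is its own resolution and ALL its places pass the mutated predicate. [folklore] -/
theorem nonRuledCofinite_false_without_singularCentre :
    ¬ NonRuledCofiniteWithoutSingularCentre :=
  fun h => infinite_mutatedSet_polyModel (AlgebraicClosure (ZMod 2))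
    (h _ (RatFunc (AlgebraicClosure (ZMod 2))) (polyModel _) (polyModel_fg _) inferInstance
      (hasResolution_spec _ _ (polyModel_fg _)))

/-! ## (b) TIGHTNESS of the threshold `2` in conjunct (5)

With `1 ≤ dim` in place of `2 ≤ dim` NO valuation ring passes conjuncts (2), (3) together with
`R ⊆ W`: the algebra `A = R ⊔ B` generated by `R` and the `B` of (3) is an affine model of `K`
inside `W` whose local ring at the centre is `W` itself — a DVR, regular of dimension one.  So the
threshold-`1` (or threshold-free) version of the crux holds VACUOUSLY for every `R`, resolution or
not: `2` is the first value with content (and `3` is false for surfaces, see the docblock). -/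

/-- A bigger subalgebra of an affine model is an affine model. [folklore] -/
theorem isFractionRing_of_le' {k K : Type} [Field k] [Field K] [Algebra k K]
    {A A' : Subalgebra k K} (hle : A ≤ A') (hA : IsFractionRing A K) : IsFractionRing A' K := by
  refine IsFractionRing.of_field A' K fun z => ?_
  obtain ⟨a, b, -, rfl⟩ := IsFractionRing.div_surjective (A := A) z
  exact ⟨⟨a, hle a.2⟩, ⟨b, hle b.2⟩, rfl⟩

/-- **Every DVR `W ⊇ R` essentially of finite type dominates a regular local ring of dimension
`≥ 1` of an affine model — namely itself** (`A = R ⊔ B`, `A_{𝔪_W ∩ A} ≅ W`). [folklore] -/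
theorem exists_goodModel_of_dim_one {k K : Type} [Field k] [Field K] [Algebra k K]
    (R : Subalgebra k K) (hR : R.FG) (hfr : IsFractionRing R K) (W : ValuationSubring K)
    (hdvr : IsDiscreteValuationRing W)
    (hft : ∃ B : Subalgebra k K, B.FG ∧ B.toSubring ≤ W.toSubring ∧ ∀ x : K, x ∈ W →
      ∃ b s : K, b ∈ B ∧ s ∈ B ∧ s ∉ W.nonunits ∧ x * s = b)
    (hRW : R.toSubring ≤ W.toSubring) :
    ∃ A : Subalgebra k K, A.FG ∧ IsFractionRing A K ∧ ∃ h : A.toSubring ≤ W.toSubring,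
      IsRegularLocalRing (Localization.AtPrime
        (Ideal.comap (Subring.inclusion h) (IsLocalRing.maximalIdeal W))) ∧
      (1 : WithBot ℕ∞) ≤ ringKrullDim (Localization.AtPrime
        (Ideal.comap (Subring.inclusion h) (IsLocalRing.maximalIdeal W))) := by
  obtain ⟨B, hB, hBW, hsurj⟩ := hft
  -- `W` as a `k`-subalgebra, and `A = R ⊔ B ⊆ W`
  let W' : Subalgebra k K :=
    { W.toSubring with
      algebraMap_mem' := fun c => hRW (R.algebraMap_mem c) }
  have hRW' : R ≤ W' := fun x hx => hRW hx
  have hBW' : B ≤ W' := fun x hx => hBW hx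
  let A : Subalgebra k K := R ⊔ B
  have hAW : A.toSubring ≤ W.toSubring := fun x hx => (sup_le hRW' hBW' : A ≤ W') hx
  refine ⟨A, hR.sup hB, isFractionRing_of_le' le_sup_left hfr, hAW, ?_⟩
  set 𝔮 := Ideal.comap (Subring.inclusion hAW) (IsLocalRing.maximalIdeal W)
  -- the localization `A_𝔮 → W` is bijective
  have hunits : ∀ y : 𝔮.primeCompl, IsUnit (Subring.inclusion hAW y) := by
    intro y
    by_contra hy
    exact y.2 ((IsLocalRing.mem_maximalIdeal _).mpr hy)
  let f : Localization.AtPrime 𝔮 →+* W := IsLocalization.lift (M := 𝔮.primeCompl) hunits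
  have hf_inj : Function.Injective f := by
    refine (IsLocalization.lift_injective_iff _).mpr fun x y => ?_
    constructor
    · intro hxy
      exact congrArg _ ((IsLocalization.injective (Localization.AtPrime 𝔮)
        𝔮.primeCompl_le_nonZeroDivisors) hxy)
    · intro hxy
      have h1 : ((Subring.inclusion hAW x : W) : K) = (Subring.inclusion hAW y : W) :=
        congrArg (fun z : W => (z : K)) hxy
      have hxy' : (x : K) = y := h1
      rw [Subtype.ext hxy']
  have hf_surj : Function.Surjective f := by
    intro w
    obtain ⟨b, s, hb, hs, hsu, hws⟩ := hsurj w w.2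
    have hs𝔮 : (⟨s, le_sup_right (b := B) hs⟩ : A) ∈ 𝔮.primeCompl := by
      intro hmem
      apply hsu
      have := (ValuationSubring.coe_mem_nonunits_iff (A := W)).mpr (Ideal.mem_comap.mp hmem)
      exact this
    refine ⟨IsLocalization.mk' _ (⟨b, le_sup_right (b := B) hb⟩ : A) ⟨_, hs𝔮⟩, ?_⟩
    rw [IsLocalization.lift_mk'_spec]
    apply Subtype.ext
    change b = s * (w : K)
    rw [mul_comm, hws]
  let e : Localization.AtPrime 𝔮 ≃+* W := RingEquiv.ofBijective f ⟨hf_inj, hf_surj⟩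
  haveI := hdvr
  refine ⟨IsRegularLocalRing.of_ringEquiv e.symm, ?_⟩
  rw [ringKrullDim_eq_of_ringEquiv e,
    IsPrincipalIdealRing.ringKrullDim_eq_one W (IsDiscreteValuationRing.not_isField W)]

/-- **THRESHOLD `≤ 1` IS VACUOUS**: the crux with `2 ≤ dim` replaced by `1 ≤ dim` in conjunct (5)
holds for every affine model `R`, with NO resolution hypothesis — its set is empty. [folklore] -/
theorem nonRuledCofinite_threshold_one_vacuous :
    ∀ (k K : Type) [Field k] [Field K] [Algebra k K] (R : Subalgebra k K), R.FG →
      IsFractionRing R K →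
      {W : ValuationSubring K | (∀ c : k, algebraMap k K c ∈ W) ∧ IsDiscreteValuationRing W ∧
        (∃ B : Subalgebra k K, B.FG ∧ B.toSubring ≤ W.toSubring ∧ ∀ x : K, x ∈ W →
          ∃ b s : K, b ∈ B ∧ s ∈ B ∧ s ∉ W.nonunits ∧ x * s = b) ∧
        (∃ h : R.toSubring ≤ W.toSubring, ¬ IsRegularLocalRing (Localization.AtPrime
          (Ideal.comap (Subring.inclusion h) (IsLocalRing.maximalIdeal W)))) ∧
        ¬ (∃ A : Subalgebra k K, A.FG ∧ IsFractionRing A K ∧ ∃ h : A.toSubring ≤ W.toSubring,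
          IsRegularLocalRing (Localization.AtPrime
            (Ideal.comap (Subring.inclusion h) (IsLocalRing.maximalIdeal W))) ∧
          (1 : WithBot ℕ∞) ≤ ringKrullDim (Localization.AtPrime
            (Ideal.comap (Subring.inclusion h) (IsLocalRing.maximalIdeal W))))} = ∅ := by
  intro k K _ _ _ R hR hfr
  refine Set.eq_empty_iff_forall_notMem.mpr ?_
  rintro W ⟨-, hdvr, hft, ⟨hRW, -⟩, hno⟩
  exact hno (exists_goodModel_of_dim_one R hR hfr W hdvr hft hRW)

/-! ## §Cusp — the cuspidal model `k[t², t³] ⊆ k(t)`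

The cheapest SINGULAR affine model with a resolution in the tree (`hasResolution_of_dim_le_one` is
unconditional).  Its local ring at the cusp is not regular because it is not integrally closed
(`t² ∈ R`, `t ∉ R_𝔮`: every element of `R = k + t²k[t]` has vanishing `t¹`-coefficient). -/

/-- **Non-normality test for non-regularity** (general): if `t ∈ K = Frac R₀` has `tⁿ ∈ R₀`
(`n > 0`) but `t ≠ a/s` for all `a ∈ R₀`, `s ∈ R₀ ∖ 𝔮`, then `(R₀)_𝔮` is not a regular local ring
(regular ⇒ integrally closed, `isIntegrallyClosed_of_isRegularLocalRing`). [folklore] -/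
theorem not_isRegularLocalRing_localization_of_pow_mem {R₀ K : Type*} [CommRing R₀] [IsDomain R₀]
    [Field K] [Algebra R₀ K] [IsFractionRing R₀ K] (𝔮 : Ideal R₀) [𝔮.IsPrime] (t : K) {n : ℕ}
    (hn : 0 < n) (htn : ∃ r : R₀, algebraMap R₀ K r = t ^ n)
    (hne : ∀ a s : R₀, s ∉ 𝔮 → t * algebraMap R₀ K s ≠ algebraMap R₀ K a) :
    ¬ IsRegularLocalRing (Localization.AtPrime 𝔮) := by
  intro hreg
  have hunits : ∀ y : 𝔮.primeCompl, IsUnit (algebraMap R₀ K y) := by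
    intro y
    refine isUnit_iff_ne_zero.mpr ?_
    rw [Ne, FaithfulSMul.algebraMap_eq_zero_iff]
    rintro h0
    exact y.2 (h0 ▸ 𝔮.zero_mem)
  letI : Algebra (Localization.AtPrime 𝔮) K :=
    (IsLocalization.lift (M := 𝔮.primeCompl) hunits).toAlgebra
  haveI : IsScalarTower R₀ (Localization.AtPrime 𝔮) K :=
    IsScalarTower.of_algebraMap_eq fun x => by
      rw [RingHom.algebraMap_toAlgebra]
      exact (IsLocalization.lift_eq hunits x).symm
  haveI : IsFractionRing (Localization.AtPrime 𝔮) K :=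
    IsFractionRing.isFractionRing_of_isDomain_of_isLocalization 𝔮.primeCompl
      (Localization.AtPrime 𝔮) K
  haveI : IsIntegrallyClosed (Localization.AtPrime 𝔮) :=
    isIntegrallyClosed_of_isRegularLocalRing (Localization.AtPrime 𝔮)
  have htn' : IsIntegral (Localization.AtPrime 𝔮) (t ^ n) := by
    obtain ⟨r, hr⟩ := htn
    rw [← hr, IsScalarTower.algebraMap_apply R₀ (Localization.AtPrime 𝔮) K]
    exact isIntegral_algebraMap
  obtain ⟨y, hy⟩ := IsIntegrallyClosed.exists_algebraMap_eq_of_isIntegral_pow hn htn'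
  obtain ⟨⟨a, s⟩, rfl⟩ := IsLocalization.mk'_surjective 𝔮.primeCompl y
  have e := congrArg (algebraMap (Localization.AtPrime 𝔮) K)
    (IsLocalization.mk'_spec (Localization.AtPrime 𝔮) a s)
  rw [map_mul, hy, ← IsScalarTower.algebraMap_apply, ← IsScalarTower.algebraMap_apply] at e
  exact hne a s s.2 e

variable (k)

/-- The cuspidal affine model `k[t², t³] ⊆ k(t)` (`t = RatFunc.X`). -/
def cuspModel : Subalgebra k (RatFunc k) :=
  Algebra.adjoin k {(RatFunc.X : RatFunc k) ^ 2, (RatFunc.X : RatFunc k) ^ 3}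

theorem cuspModel_fg : (cuspModel k).FG :=
  Subalgebra.fg_def.mpr ⟨_, (Set.finite_singleton _).insert _, rfl⟩

theorem pow_mem_cuspModel {m : ℕ} (hm : 2 ≤ m) : (RatFunc.X : RatFunc k) ^ m ∈ cuspModel k := by
  induction m using Nat.strong_induction_on with
  | _ m ih =>
    rcases Nat.lt_or_ge m 4 with h4 | h4
    · interval_cases m
      · exact Algebra.subset_adjoin (by simp)
      · exact Algebra.subset_adjoin (by simp)
    · have : (RatFunc.X : RatFunc k) ^ m = RatFunc.X ^ 2 * RatFunc.X ^ (m - 2) := by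
        rw [← pow_add]; congr 1; omega
      rw [this]
      exact Subalgebra.mul_mem _ (Algebra.subset_adjoin (by simp))
        (ih (m - 2) (by omega) (by omega))

/-- `t² · k[t] ⊆ k[t², t³]`. -/
theorem Xsq_mul_algebraMap_mem_cuspModel (p : k[X]) :
    (RatFunc.X : RatFunc k) ^ 2 * algebraMap k[X] (RatFunc k) p ∈ cuspModel k := by
  induction p using Polynomial.induction_on' with
  | add p q hp hq =>
    rw [map_add, mul_add]
    exact Subalgebra.add_mem _ hp hq
  | monomial n c =>
    rw [← C_mul_X_pow_eq_monomial, map_mul, map_pow, RatFunc.algebraMap_X,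
      Polynomial.C_eq_algebraMap, ← IsScalarTower.algebraMap_apply, ← mul_assoc,
      mul_comm (RatFunc.X ^ 2), mul_assoc, ← pow_add]
    exact Subalgebra.mul_mem _ (Subalgebra.algebraMap_mem _ c) (pow_mem_cuspModel k (by omega))

theorem cuspModel_le_polyModel : cuspModel k ≤ polyModel k := by
  refine Algebra.adjoin_le ?_
  rintro _ (rfl | rfl)
  · have h := algebraMap_mem_polyModel k (X ^ 2)
    rwa [map_pow, RatFunc.algebraMap_X] at h
  · have h := algebraMap_mem_polyModel k (X ^ 3)
    rwa [map_pow, RatFunc.algebraMap_X] at h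

instance isFractionRing_cuspModel : IsFractionRing (cuspModel k) (RatFunc k) := by
  refine IsFractionRing.of_field (cuspModel k) (RatFunc k) fun z => ?_
  refine ⟨⟨_, Xsq_mul_algebraMap_mem_cuspModel k z.num⟩,
    ⟨_, Xsq_mul_algebraMap_mem_cuspModel k z.denom⟩, ?_⟩
  change z = (RatFunc.X ^ 2 * _) / (RatFunc.X ^ 2 * _)
  rw [mul_div_mul_left _ _ (pow_ne_zero 2 RatFunc.X_ne_zero), RatFunc.num_div_denom]

/-- The invariant separating `k[t², t³]` from `k[t]`: vanishing `t¹`-coefficient. -/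
theorem exists_coeff_one_eq_zero_of_mem_cuspModel {x : RatFunc k} (hx : x ∈ cuspModel k) :
    ∃ p : k[X], p.coeff 1 = 0 ∧ algebraMap k[X] (RatFunc k) p = x := by
  induction hx using Algebra.adjoin_induction with
  | mem x hx =>
    rcases hx with rfl | rfl
    · exact ⟨X ^ 2, by simp [Polynomial.coeff_X_pow], by simp⟩
    · exact ⟨X ^ 3, by simp [Polynomial.coeff_X_pow], by simp⟩
  | algebraMap c =>
    exact ⟨C c, by simp, by rw [Polynomial.C_eq_algebraMap, ← IsScalarTower.algebraMap_apply]⟩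
  | add x y _ _ hx hy =>
    obtain ⟨p, hp, rfl⟩ := hx
    obtain ⟨q, hq, rfl⟩ := hy
    exact ⟨p + q, by simp [hp, hq], by simp⟩
  | mul x y _ _ hx hy =>
    obtain ⟨p, hp, rfl⟩ := hx
    obtain ⟨q, hq, rfl⟩ := hy
    refine ⟨p * q, ?_, by simp⟩
    simp [Polynomial.coeff_mul, Finset.Nat.sum_antidiagonal_eq_sum_range_succ_mk,
      Finset.sum_range_succ, hp, hq]

/-- KEY COMPUTATION: `t · s = a` with `a, s ∈ k[t², t³]` forces `s(0) = 0`. -/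
theorem coeff_zero_eq_zero_of_X_mul {a s : RatFunc k} (ha : a ∈ cuspModel k)
    (hs : s ∈ cuspModel k) (hts : RatFunc.X * s = a) {ps : k[X]}
    (hps : algebraMap k[X] (RatFunc k) ps = s) : ps.coeff 0 = 0 := by
  obtain ⟨pa, hpa1, rfl⟩ := exists_coeff_one_eq_zero_of_mem_cuspModel k ha
  obtain ⟨ps', -, rfl⟩ := exists_coeff_one_eq_zero_of_mem_cuspModel k hs
  have hinj := FaithfulSMul.algebraMap_injective k[X] (RatFunc k)
  obtain rfl : ps = ps' := hinj hps
  have hX : X * ps = pa := hinj (by rw [map_mul, RatFunc.algebraMap_X]; exact hts)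
  have := congrArg (fun p : k[X] => p.coeff 1) hX
  simp only [Polynomial.coeff_X_mul] at this
  rw [this, hpa1]

/-- The place of `k(t)` at `t = 0`. -/
abbrev cuspPlace : ValuationSubring (RatFunc k) := place (Polynomial.idealX k)

theorem cuspModel_le_cuspPlace : (cuspModel k).toSubring ≤ (cuspPlace k).toSubring :=
  fun _ hx => polyModel_le_place _ (cuspModel_le_polyModel k hx)

/-- An element of `k[t]` is a non-unit of the place `t = 0` iff its constant term vanishes. -/
theorem algebraMap_mem_nonunits_cuspPlace_iff (p : k[X]) :
    algebraMap k[X] (RatFunc k) p ∈ (cuspPlace k).nonunits ↔ p.coeff 0 = 0 := by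
  rw [← Polynomial.X_dvd_iff, ← Ideal.mem_span_singleton, ← Polynomial.idealX_span,
    ← IsLocalization.AtPrime.to_map_mem_maximal_iff (cuspPlace k) (Polynomial.idealX k).asIdeal p,
    ← ValuationSubring.coe_mem_nonunits_iff]
  rfl

/-- `t ≠ a / s` for `a, s ∈ k[t², t³]` with `s(0) ≠ 0` (i.e. `s` a unit at the cusp):
`t ∉ R_𝔮`, in the multiplicative form `t · s ≠ a`. -/
theorem X_mul_ne_of_not_mem_nonunits {a s : RatFunc k} (ha : a ∈ cuspModel k)
    (hs : s ∈ cuspModel k) (hsu : s ∉ (cuspPlace k).nonunits) : RatFunc.X * s ≠ a := by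
  intro hts
  obtain ⟨ps, -, hps⟩ := exists_coeff_one_eq_zero_of_mem_cuspModel k hs
  apply hsu
  rw [← hps, algebraMap_mem_nonunits_cuspPlace_iff]
  exact coeff_zero_eq_zero_of_X_mul k ha hs hts hps

/-- **The local ring of the cusp is not regular** (crux conjunct (4) holds for
`W = k[t]_{(t)} ⊇ R = k[t², t³]`): `t² ∈ R` but `t ∉ R_𝔮`. -/
theorem not_isRegularLocalRing_cusp (h : (cuspModel k).toSubring ≤ (cuspPlace k).toSubring) :
    ¬ IsRegularLocalRing (Localization.AtPrime
      (Ideal.comap (Subring.inclusion h) (IsLocalRing.maximalIdeal (cuspPlace k)))) := by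
  refine not_isRegularLocalRing_localization_of_pow_mem (R₀ := cuspModel k)
    (Ideal.comap (Subring.inclusion h) (IsLocalRing.maximalIdeal (cuspPlace k)))
    (RatFunc.X : RatFunc k) two_pos ⟨⟨RatFunc.X ^ 2, Algebra.subset_adjoin (by simp)⟩, rfl⟩ ?_
  intro a s hs
  refine X_mul_ne_of_not_mem_nonunits k a.2 s.2 fun hsu => hs ?_
  rw [Ideal.mem_comap, ← ValuationSubring.coe_mem_nonunits_iff]
  exact hsu

/-- **(b) The exceptional set of the crux is NON-EMPTY at the cusp**: `W = k[t]_{(t)}` satisfies all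
five conjuncts for `R = k[t², t³] ⊆ k(t)`.  So `Set.Finite` cannot be improved to `= ∅`, and the
typed conjuncts (1)–(5) are jointly satisfiable (non-vacuity of the crux's predicate). -/
theorem cuspPlace_mem_exceptionalSet :
    cuspPlace k ∈ {W : ValuationSubring (RatFunc k) | (∀ c : k, algebraMap k (RatFunc k) c ∈ W) ∧
      IsDiscreteValuationRing W ∧
      (∃ B : Subalgebra k (RatFunc k), B.FG ∧ B.toSubring ≤ W.toSubring ∧ ∀ x : RatFunc k,
        x ∈ W → ∃ b s : RatFunc k, b ∈ B ∧ s ∈ B ∧ s ∉ W.nonunits ∧ x * s = b) ∧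
      (∃ h : (cuspModel k).toSubring ≤ W.toSubring, ¬ IsRegularLocalRing (Localization.AtPrime
        (Ideal.comap (Subring.inclusion h) (IsLocalRing.maximalIdeal W)))) ∧
      ¬ (∃ A : Subalgebra k (RatFunc k), A.FG ∧ IsFractionRing A (RatFunc k) ∧
        ∃ h : A.toSubring ≤ W.toSubring,
        IsRegularLocalRing (Localization.AtPrime
          (Ideal.comap (Subring.inclusion h) (IsLocalRing.maximalIdeal W))) ∧
        (2 : WithBot ℕ∞) ≤ ringKrullDim (Localization.AtPrime
          (Ideal.comap (Subring.inclusion h) (IsLocalRing.maximalIdeal W))))} :=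
  ⟨algebraMap_base_mem_place _, inferInstance, place_essFiniteType _,
    ⟨cuspModel_le_cuspPlace k, not_isRegularLocalRing_cusp k _⟩, not_exists_goodModel _⟩

/-- **NATURAL STRENGTHENING REFUTED: "the exceptional set is empty" is false** (the crux with
`Set.Finite` replaced by `= ∅`, everything else verbatim), at `R = k[t², t³] ⊆ k(t)`, `k = 𝔽₂^alg`
(any field works). [folklore] -/
theorem not_nonRuledCofinite_empty :
    ¬ ∀ (k K : Type) [Field k] [Field K] [Algebra k K] (R : Subalgebra k K), R.FG →
      IsFractionRing R K →
      Literature.AlgebraicGeometry.Resolution.Scheme.HasResolution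
        (AlgebraicGeometry.Spec (CommRingCat.of R)) →
      {W : ValuationSubring K | (∀ c : k, algebraMap k K c ∈ W) ∧ IsDiscreteValuationRing W ∧
        (∃ B : Subalgebra k K, B.FG ∧ B.toSubring ≤ W.toSubring ∧ ∀ x : K, x ∈ W →
          ∃ b s : K, b ∈ B ∧ s ∈ B ∧ s ∉ W.nonunits ∧ x * s = b) ∧
        (∃ h : R.toSubring ≤ W.toSubring, ¬ IsRegularLocalRing (Localization.AtPrime
          (Ideal.comap (Subring.inclusion h) (IsLocalRing.maximalIdeal W)))) ∧
        ¬ (∃ A : Subalgebra k K, A.FG ∧ IsFractionRing A K ∧ ∃ h : A.toSubring ≤ W.toSubring,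
          IsRegularLocalRing (Localization.AtPrime
            (Ideal.comap (Subring.inclusion h) (IsLocalRing.maximalIdeal W))) ∧
          (2 : WithBot ℕ∞) ≤ ringKrullDim (Localization.AtPrime
            (Ideal.comap (Subring.inclusion h) (IsLocalRing.maximalIdeal W))))} = ∅ := by
  intro h
  have he := h (AlgebraicClosure (ZMod 2)) (RatFunc (AlgebraicClosure (ZMod 2))) (cuspModel _)
    (cuspModel_fg _) inferInstance (hasResolution_spec _ _ (cuspModel_fg _))
  exact (Set.eq_empty_iff_forall_notMem.mp he) _ (cuspPlace_mem_exceptionalSet _)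

/-! ## §Line `regular-atlas` — stub 2 needs `IsRegularRing B`

`stub_exceptionalCentre` (Lines/regular_atlas.lean) with the hypothesis `IsRegularRing B` deleted
is FALSE at the cusp `R = B = k[t², t³]`, `W = k[t]_{(t)}`: the `Sing` clause and the no-good-model
clause hold, but `W ≠ B_𝔭` elementwise (`t ∈ W`, `t ≠ a/s` with `s(0) ≠ 0`).  (Information for the
lead: regularity of the chart is exactly what makes `W = B_𝔭`; the stub as registered keeps it.) -/

/-- `stub_exceptionalCentre` WITHOUT `IsRegularRing B` is false. [folklore] -/
theorem stub_exceptionalCentre_false_without_isRegularRing :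
    ¬ ∀ (k K : Type) [Field k] [Field K] [Algebra k K] (R B : Subalgebra k K), R ≤ B → B.FG →
      IsFractionRing B K →
      ∀ (W : ValuationSubring K) (hBW : B.toSubring ≤ W.toSubring),
        (∃ h : R.toSubring ≤ W.toSubring, ¬ IsRegularLocalRing (Localization.AtPrime
          (Ideal.comap (Subring.inclusion h) (IsLocalRing.maximalIdeal W)))) →
        (¬ ∃ A : Subalgebra k K, A.FG ∧ IsFractionRing A K ∧ ∃ h : A.toSubring ≤ W.toSubring,
          IsRegularLocalRing (Localization.AtPrime
            (Ideal.comap (Subring.inclusion h) (IsLocalRing.maximalIdeal W))) ∧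
          (2 : WithBot ℕ∞) ≤ ringKrullDim (Localization.AtPrime
            (Ideal.comap (Subring.inclusion h) (IsLocalRing.maximalIdeal W)))) →
        (centreIdeal B W hBW).height = 1 ∧
          ∀ z : K, z ∈ W ↔ ∃ a s : B, s ∉ centreIdeal B W hBW ∧ z = a / s := by
  intro h
  obtain ⟨-, hmem⟩ := h (AlgebraicClosure (ZMod 2)) (RatFunc (AlgebraicClosure (ZMod 2)))
    (cuspModel _) (cuspModel _) le_rfl (cuspModel_fg _) inferInstance (cuspPlace _)
    (cuspModel_le_cuspPlace _) ⟨cuspModel_le_cuspPlace _, not_isRegularLocalRing_cusp _ _⟩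
    (not_exists_goodModel _)
  obtain ⟨a, s, hs, hts⟩ := (hmem RatFunc.X).mp (algebraMap_mem_place _ X)
  have hsu : (s : RatFunc (AlgebraicClosure (ZMod 2))) ∉ (cuspPlace _).nonunits :=
    fun hsu => hs ((mem_centreIdeal_iff_coe_mem_nonunits _ _ _ s).mpr hsu)
  have hs0 : (s : RatFunc (AlgebraicClosure (ZMod 2))) ≠ 0 := by
    rintro h0
    exact hsu (h0 ▸ (cuspPlace _).nonunits.zero_mem')
  exact X_mul_ne_of_not_mem_nonunits _ a.2 s.2 hsu (by rw [hts, div_mul_cancel₀ _ hs0])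

/-! ## §Line `regular-atlas` — stub 3 needs its height-one clause: the cusp × line

`stub_exceptionalPrimesFinite` with `𝔭.asIdeal.height = 1` deleted is FALSE at
`R = k[t², t³, y] ≤ B = k[t, y] ⊆ K = k(t, y)`: every maximal ideal `(t, y - c)` of the regular
chart contracts to a point of the singular line of `Spec R` (non-regular: `t² ∈ R`, `t ∉ R_𝔮`).
Landed as `Theorems/NonRuledCofinite/Negative/StubExceptionalPrimesWithoutHeightOne.lean`. -/

section CuspTimesLine

variable (k : Type) [Field k]

/-- `k(t, y)` realised as the fraction field of `k[y][t]` (outer variable `t`, inner `y`). [folklore] -/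
abbrev K₂ : Type := FractionRing k[X][X]

/-- `t ∈ k(t, y)`. [folklore] -/
abbrev tK : K₂ k := algebraMap k[X][X] (K₂ k) X

/-- `y ∈ k(t, y)`. [folklore] -/
abbrev yK : K₂ k := algebraMap k[X][X] (K₂ k) (C X)

/-- The canonical `k`-algebra map `k[y][t] → k(t, y)`. [folklore] -/
abbrev toK₂ : k[X][X] →ₐ[k] K₂ k := IsScalarTower.toAlgHom k k[X][X] (K₂ k)

/-- `k[y][t] → k(t, y)` is injective. [folklore] -/
theorem toK₂_injective : Function.Injective (toK₂ k) := IsFractionRing.injective k[X][X] (K₂ k)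

/-- The regular chart `B = k[t, y] ⊆ k(t, y)`. [folklore] -/
def planeModel : Subalgebra k (K₂ k) := (toK₂ k).range

/-- `k[t, y] ≅ k[y][t]`. [folklore] -/
def planeModelEquiv : k[X][X] ≃ₐ[k] planeModel k := AlgEquiv.ofInjective (toK₂ k) (toK₂_injective k)

/-- The chart isomorphism is the canonical map on underlying elements. [folklore] -/
theorem coe_planeModelEquiv (P : k[X][X]) :
    ((planeModelEquiv k P : planeModel k) : K₂ k) = algebraMap k[X][X] (K₂ k) P := rfl

/-- The inverse chart isomorphism recovers the polynomial. [folklore] -/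
theorem planeModelEquiv_symm_apply (P : k[X][X]) (h : algebraMap k[X][X] (K₂ k) P ∈ planeModel k) :
    (planeModelEquiv k).symm ⟨algebraMap k[X][X] (K₂ k) P, h⟩ = P := by
  apply (planeModelEquiv k).injective
  rw [AlgEquiv.apply_symm_apply]
  exact Subtype.ext (coe_planeModelEquiv k P).symm

/-- Membership in the chart: images of polynomials. [folklore] -/
theorem mem_planeModel_iff {x : K₂ k} : x ∈ planeModel k ↔ ∃ P : k[X][X], algebraMap k[X][X] (K₂ k) P = x := by
  simp [planeModel, AlgHom.mem_range]

/-- `k[t, y]` is finitely generated. [folklore] -/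
theorem planeModel_fg : (planeModel k).FG := by
  have h : (⊤ : Subalgebra k k[X][X]).FG := Algebra.FiniteType.out
  have := h.map (toK₂ k)
  rwa [Algebra.map_top] at this

/-- `k[t, y]` is a regular ring (polynomial rings over a field). [folklore] -/
instance isRegularRing_planeModel : IsRegularRing (planeModel k) :=
  IsRegularRing.of_ringEquiv (planeModelEquiv k).toRingEquiv

/-- The cusp × line `R = k[t², t³, y]`. [folklore] -/
def cuspLineModel : Subalgebra k (K₂ k) := Algebra.adjoin k {tK k ^ 2, tK k ^ 3, yK k}

/-- `k[t², t³, y]` is finitely generated. [folklore] -/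
theorem cuspLineModel_fg : (cuspLineModel k).FG :=
  Subalgebra.fg_def.mpr ⟨_, ((Set.finite_singleton _).insert _).insert _, rfl⟩

/-- `k[t², t³, y] ⊆ k[t, y]`. [folklore] -/
theorem cuspLineModel_le_planeModel : cuspLineModel k ≤ planeModel k := by
  refine Algebra.adjoin_le ?_
  rintro _ (rfl | rfl | rfl)
  · exact ⟨X ^ 2, by simp⟩
  · exact ⟨X ^ 3, by simp⟩
  · exact ⟨C X, rfl⟩

/-- `tᵐ ∈ k[t², t³, y]` for `m ≥ 2`. [folklore] -/
theorem pow_mem_cuspLineModel {m : ℕ} (hm : 2 ≤ m) : tK k ^ m ∈ cuspLineModel k := by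
  induction m using Nat.strong_induction_on with
  | _ m ih =>
    rcases Nat.lt_or_ge m 4 with h4 | h4
    · interval_cases m
      · exact Algebra.subset_adjoin (by simp)
      · exact Algebra.subset_adjoin (by simp)
    · have : tK k ^ m = tK k ^ 2 * tK k ^ (m - 2) := by
        rw [← pow_add]; congr 1; omega
      rw [this]
      exact Subalgebra.mul_mem _ (Algebra.subset_adjoin (by simp))
        (ih (m - 2) (by omega) (by omega))

/-- `k[y] ⊆ k[t², t³, y]`. [folklore] -/
theorem algebraMap_C_mem_cuspLineModel (a : k[X]) :
    algebraMap k[X][X] (K₂ k) (C a) ∈ cuspLineModel k := by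
  induction a using Polynomial.induction_on' with
  | add p q hp hq =>
    rw [map_add, map_add]
    exact Subalgebra.add_mem _ hp hq
  | monomial n c =>
    rw [← C_mul_X_pow_eq_monomial, map_mul, map_pow, map_mul, map_pow]
    refine Subalgebra.mul_mem _ ?_ (Subalgebra.pow_mem _ (Algebra.subset_adjoin (by simp)) n)
    have : (C (C c) : k[X][X]) = algebraMap k k[X][X] c := by
      rw [Polynomial.algebraMap_apply, Polynomial.algebraMap_eq]
    rw [this, ← IsScalarTower.algebraMap_apply]
    exact Subalgebra.algebraMap_mem _ c

/-- `t² · k[t, y] ⊆ k[t², t³, y]`. [folklore] -/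
theorem tsq_mul_algebraMap_mem_cuspLineModel (P : k[X][X]) :
    tK k ^ 2 * algebraMap k[X][X] (K₂ k) P ∈ cuspLineModel k := by
  induction P using Polynomial.induction_on' with
  | add p q hp hq =>
    rw [map_add, mul_add]
    exact Subalgebra.add_mem _ hp hq
  | monomial n a =>
    rw [← C_mul_X_pow_eq_monomial, map_mul, map_pow, ← mul_assoc, mul_comm (tK k ^ 2), mul_assoc,
      ← pow_add]
    exact Subalgebra.mul_mem _ (algebraMap_C_mem_cuspLineModel k a)
      (pow_mem_cuspLineModel k (by omega))

/-- `t ≠ 0`. [folklore] -/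
theorem tK_ne_zero : tK k ≠ 0 := by
  rw [Ne, FaithfulSMul.algebraMap_eq_zero_iff]
  exact X_ne_zero

/-- `Frac k[t², t³, y] = k(t, y)` (`z = t²a / t²b`). [folklore] -/
instance isFractionRing_cuspLineModel : IsFractionRing (cuspLineModel k) (K₂ k) := by
  refine IsFractionRing.of_field (cuspLineModel k) (K₂ k) fun z => ?_
  obtain ⟨a, b, -, rfl⟩ := IsFractionRing.div_surjective (A := k[X][X]) z
  refine ⟨⟨_, tsq_mul_algebraMap_mem_cuspLineModel k a⟩,
    ⟨_, tsq_mul_algebraMap_mem_cuspLineModel k b⟩, ?_⟩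
  change _ = (tK k ^ 2 * _) / (tK k ^ 2 * _)
  rw [mul_div_mul_left _ _ (pow_ne_zero 2 (tK_ne_zero k))]

/-- The invariant of `k[t², t³, y]`: vanishing `t¹`-coefficient (in `k[y]`). [folklore] -/
theorem exists_coeff_one_eq_zero_of_mem_cuspLineModel {x : K₂ k} (hx : x ∈ cuspLineModel k) :
    ∃ P : k[X][X], P.coeff 1 = 0 ∧ algebraMap k[X][X] (K₂ k) P = x := by
  induction hx using Algebra.adjoin_induction with
  | mem x hx =>
    rcases hx with rfl | rfl | rfl
    · exact ⟨X ^ 2, by simp [Polynomial.coeff_X_pow], by simp⟩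
    · exact ⟨X ^ 3, by simp [Polynomial.coeff_X_pow], by simp⟩
    · exact ⟨C X, by simp, rfl⟩
  | algebraMap c =>
    refine ⟨C (C c), by simp, ?_⟩
    rw [IsScalarTower.algebraMap_apply k k[X][X] (K₂ k), Polynomial.algebraMap_apply,
      Polynomial.algebraMap_eq]
  | add x y _ _ hx hy =>
    obtain ⟨p, hp, rfl⟩ := hx
    obtain ⟨q, hq, rfl⟩ := hy
    exact ⟨p + q, by simp [hp, hq], by simp⟩
  | mul x y _ _ hx hy =>
    obtain ⟨p, hp, rfl⟩ := hx
    obtain ⟨q, hq, rfl⟩ := hy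
    refine ⟨p * q, ?_, by simp⟩
    simp [Polynomial.coeff_mul, Finset.Nat.sum_antidiagonal_eq_sum_range_succ_mk,
      Finset.sum_range_succ, hp, hq]

/-- Evaluation at the point `(t, y) = (0, c)`. [folklore] -/
abbrev evPoint (c : k) : k[X][X] →+* k := eval₂RingHom (evalRingHom c) 0

/-- Evaluation at `(0, c)` reads the constant-in-`t` coefficient at `y = c`. [folklore] -/
theorem evPoint_apply (c : k) (P : k[X][X]) : evPoint k c P = (P.coeff 0).eval c := by
  simp [evPoint, eval₂_at_zero]

/-- The maximal ideal `(t, y - c)` of the chart `k[t, y]`, as the kernel of evaluation at `(0, c)`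
transported to `planeModel`. [folklore] -/
def pointIdeal (c : k) : Ideal (planeModel k) :=
  Ideal.comap ((planeModelEquiv k).symm : planeModel k →+* k[X][X]) (RingHom.ker (evPoint k c))

/-- `(t, y - c)` is prime. [folklore] -/
instance pointIdeal_isPrime (c : k) : (pointIdeal k c).IsPrime := by
  unfold pointIdeal
  haveI : (RingHom.ker (evPoint k c)).IsPrime := RingHom.ker_isPrime _
  infer_instance

/-- Membership in `(t, y - c)`: vanishing at `(0, c)`. [folklore] -/
theorem mem_pointIdeal_iff (c : k) (P : k[X][X]) (h : algebraMap k[X][X] (K₂ k) P ∈ planeModel k) :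
    (⟨_, h⟩ : planeModel k) ∈ pointIdeal k c ↔ (P.coeff 0).eval c = 0 := by
  rw [pointIdeal, Ideal.mem_comap, RingHom.mem_ker]
  change evPoint k c ((planeModelEquiv k).symm ⟨_, h⟩) = 0 ↔ _
  rw [planeModelEquiv_symm_apply, evPoint_apply]

/-- Distinct points give distinct ideals (`y - c₁ ∈ (t, y - c₁) ∖ (t, y - c₂)`). [folklore] -/
theorem pointIdeal_injective : Function.Injective (pointIdeal k) := by
  intro c₁ c₂ h
  have hP : algebraMap k[X][X] (K₂ k) (C (X - C c₁)) ∈ planeModel k :=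
    (mem_planeModel_iff k).mpr ⟨_, rfl⟩
  have hmem : (⟨_, hP⟩ : planeModel k) ∈ pointIdeal k c₁ := by
    rw [mem_pointIdeal_iff]; simp
  rw [h, mem_pointIdeal_iff] at hmem
  simpa [sub_eq_zero, eq_comm] using hmem

/-- **The cusp × line is singular along `t = 0`**: for every `c`, the local ring of
`R = k[t², t³, y]` at the contraction of `(t, y - c)` is not regular. [folklore] -/
theorem not_isRegularLocalRing_cuspLine (c : k) :
    ¬ IsRegularLocalRing (Localization.AtPrime ((pointIdeal k c).comap
      (Subalgebra.inclusion (cuspLineModel_le_planeModel k)).toRingHom)) := by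
  refine not_isRegularLocalRing_localization_of_pow_mem (R₀ := cuspLineModel k) _ (tK k) two_pos
    ⟨⟨tK k ^ 2, Algebra.subset_adjoin (by simp)⟩, rfl⟩ ?_
  intro a s hs hts
  obtain ⟨Pa, hPa1, hPa⟩ := exists_coeff_one_eq_zero_of_mem_cuspLineModel k a.2
  obtain ⟨Ps, -, hPs⟩ := exists_coeff_one_eq_zero_of_mem_cuspLineModel k s.2
  have hinj := IsFractionRing.injective k[X][X] (K₂ k)
  have hX : X * Ps = Pa := hinj (by rw [map_mul, hPs, hPa]; exact hts)
  have h0 : Ps.coeff 0 = 0 := by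
    have := congrArg (fun p : k[X][X] => p.coeff 1) hX
    simp only [Polynomial.coeff_X_mul] at this
    rw [this, hPa1]
  apply hs
  rw [Ideal.mem_comap]
  change (⟨(s : K₂ k), cuspLineModel_le_planeModel k s.2⟩ : planeModel k) ∈ pointIdeal k c
  have hs' : (⟨(s : K₂ k), cuspLineModel_le_planeModel k s.2⟩ : planeModel k) =
      ⟨_, hPs ▸ cuspLineModel_le_planeModel k s.2⟩ := Subtype.ext hPs.symm
  rw [hs', mem_pointIdeal_iff, h0, eval_zero]

/-- Over an infinite field the set of primes `𝔭` of the chart `B = k[t, y]` with `B_𝔭` regular but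
`R_{𝔭 ∩ R}` NOT regular (`R = k[t², t³, y]`; NO height condition) is infinite. [folklore] -/
theorem infinite_exceptionalPrimes_cuspLine [Infinite k] :
    {𝔭 : PrimeSpectrum (planeModel k) |
      IsRegularLocalRing (Localization.AtPrime 𝔭.asIdeal) ∧
      ¬ IsRegularLocalRing (Localization.AtPrime
        (𝔭.asIdeal.comap (Subalgebra.inclusion (cuspLineModel_le_planeModel k)).toRingHom))}.Infinite := by
  have hinj : Function.Injective fun c : k => (⟨pointIdeal k c, inferInstance⟩ : PrimeSpectrum (planeModel k)) :=
    fun c₁ c₂ h => pointIdeal_injective k (congrArg PrimeSpectrum.asIdeal h)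
  refine Set.Infinite.mono ?_ (Set.infinite_range_of_injective hinj)
  rintro _ ⟨c, rfl⟩
  refine ⟨?_, ?_⟩
  · exact IsRegularRing.isRegularLocalRing_localization (pointIdeal k c)
  · exact not_isRegularLocalRing_cuspLine k c

end CuspTimesLine

/-- **Stub 3 of line `regular-atlas` WITHOUT its height-one clause is false.**  The statement
negated is `stub_exceptionalPrimesFinite` (`Lines/regular_atlas.lean`) with `𝔭.asIdeal.height = 1`
deleted from the set, everything else verbatim; witness `k = 𝔽₂^alg`, `K = k(t, y)`,
`R = k[t², t³, y] ≤ B = k[t, y]`: the infinitely many maximal ideals `(t, y - c)`. [folklore] -/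
theorem stub_exceptionalPrimesFinite_false_without_heightOne :
    ¬ ∀ (k K : Type) [Field k] [Field K] [Algebra k K] (R B : Subalgebra k K) (hRB : R ≤ B),
      R.FG → B.FG → IsFractionRing R K →
      {𝔭 : PrimeSpectrum B | IsRegularLocalRing (Localization.AtPrime 𝔭.asIdeal) ∧
        ¬ IsRegularLocalRing (Localization.AtPrime
          (𝔭.asIdeal.comap (Subalgebra.inclusion hRB).toRingHom))}.Finite :=
  fun h => infinite_exceptionalPrimes_cuspLine (AlgebraicClosure (ZMod 2))
    (h _ (K₂ (AlgebraicClosure (ZMod 2))) (cuspLineModel _) (planeModel _)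
      (cuspLineModel_le_planeModel _) (cuspLineModel_fg _) (planeModel_fg _) inferInstance)

end Summit.ResolutionOfSingularities.ResolutionOfSingularities.Cruxes.NonRuledCofinite.Disproof

end
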